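import Summits.RiemannHypothesis.RiemannHypothesis.Theorems.IntegerScrewCensusFastOffset
import Summits.RiemannHypothesis.RiemannHypothesis.Theorems.IntegerScrewCensusUTabDigits
import Summits.RiemannHypothesis.RiemannHypothesis.Theorems.IntegerScrewCensusBracketsPrimal

/-!
# Route `IntegerScrew` — fast kernel arithmetic for manifest-certificate checks (9): SOUNDNESS (part 1)

The pieces of `manifestCert_of_fastCheckB` (sequel `IntegerScrewCensusFastSoundB`): the remainder entries of the certificate
witness `t_k = j_k/500`, `w_k = (Ω_k/2^60)·t_k²`, `w_J = WJ/2^60` in closed form (`remainder_entry`: `R_ij = S_ij − P(log(i+2), log(j+2))`,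
diagonal `P = Pd`, symmetry), the S-entries `screw_offdiag/diag`, the range of a correct trig row (`rowSmall_of_rowOK`), the
per-pair bound `pairAbs_ge` (no truncation in the offset arithmetic of `IntegerScrewCensusFastOffset`; `2^164·|R_ab| ≤ pairAbs`),
the diagonal bound `diagLoN_le` (`diagLoN ≤ 2^164 R_aa + 2·OZ + ZB`), and the real brackets `pair_bracket` feeding `pairAbs_ge`
(numerator error `num_err`, digit brackets of `u`, `CL ≤ 2^162 ζ(2,¼) ≤ CH`).  RH-free; nothing here bears on the truth of RH.
-/

set_option linter.dupNamespace false
set_option autoImplicit false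

namespace Summit.RiemannHypothesis.RiemannHypothesis.Theorems.IntegerScrew.Manifest.Fast

open Finset
open Literature.Analysis.ValidatedNumerics Literature.Analysis.ValidatedNumerics.Numerics
open Literature.Analysis.ValidatedNumerics.KroneckerDot Literature.NumberTheory.LFunctions

/-! ### The certificate witness and its remainder -/

/-- `P(x, x) = Pd(x)` (`cos² + sin² = 1`). -/
theorem PR_diag (js oms : List ℕ) (WJ K : ℕ) (x : ℝ) : PR js oms WJ K x x = PRd js oms WJ K x := by
  unfold PR PRd
  congr 1
  refine Finset.sum_congr rfl fun k _ => ?_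
  have h := Real.cos_sq_add_sin_sq ((js.getD k 0 : ℝ) / 500 * x)
  have h' : Real.cos ((js.getD k 0 : ℝ) / 500 * x) * Real.cos ((js.getD k 0 : ℝ) / 500 * x) +
      Real.sin ((js.getD k 0 : ℝ) / 500 * x) * Real.sin ((js.getD k 0 : ℝ) / 500 * x) = 1 := by
    rw [← sq, ← sq]; exact h
  rw [h']
  ring

/-- **The remainder entries of the witness**: `R_ij = S_ij − P(log(i+2), log(j+2))` (all `j_k > 0`). -/
theorem remainder_entry {n K WJ : ℕ} {js oms : List ℕ} (hpos : ∀ k, k < K → 0 < js.getD k 0) (i j : Fin n) :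
    remainder n K (fun k : Fin K => (js.getD k 0 : ℝ) / 500)
      (fun k : Fin K => (oms.getD k 0 : ℝ) / 2 ^ 60 * ((js.getD k 0 : ℝ) / 500) ^ 2) ((WJ : ℝ) / 2 ^ 60) i j =
      screwMatrix n i j - PR js oms WJ K (Real.log ((i : ℕ) + 2 : ℕ)) (Real.log ((j : ℕ) + 2 : ℕ)) := by
  unfold remainder PR
  simp only [Matrix.sub_apply, Matrix.sum_apply, Matrix.smul_apply, smul_eq_mul, waveAtom, onesMat, node,
    Matrix.of_apply, mul_one]
  rw [Fin.sum_univ_eq_sum_range (fun k => (oms.getD k 0 : ℝ) / 2 ^ 60 * ((js.getD k 0 : ℝ) / 500) ^ 2 *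
    ((1 - Real.cos ((js.getD k 0 : ℝ) / 500 * Real.log (((i : ℕ) + 2 : ℕ) : ℝ))
      - Real.cos ((js.getD k 0 : ℝ) / 500 * Real.log (((j : ℕ) + 2 : ℕ) : ℝ))
      + Real.cos ((js.getD k 0 : ℝ) / 500 *
          (Real.log (((i : ℕ) + 2 : ℕ) : ℝ) - Real.log (((j : ℕ) + 2 : ℕ) : ℝ)))) /
        ((js.getD k 0 : ℝ) / 500) ^ 2)) K]
  have hsum : ∀ k ∈ range K,
      (oms.getD k 0 : ℝ) / 2 ^ 60 * ((js.getD k 0 : ℝ) / 500) ^ 2 *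
        ((1 - Real.cos ((js.getD k 0 : ℝ) / 500 * Real.log (((i : ℕ) + 2 : ℕ) : ℝ))
          - Real.cos ((js.getD k 0 : ℝ) / 500 * Real.log (((j : ℕ) + 2 : ℕ) : ℝ))
          + Real.cos ((js.getD k 0 : ℝ) / 500 *
              (Real.log (((i : ℕ) + 2 : ℕ) : ℝ) - Real.log (((j : ℕ) + 2 : ℕ) : ℝ)))) /
            ((js.getD k 0 : ℝ) / 500) ^ 2) =
      (oms.getD k 0 : ℝ) / 2 ^ 60 *
        (1 - Real.cos ((js.getD k 0 : ℝ) / 500 * Real.log (((i : ℕ) + 2 : ℕ) : ℝ))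
          - Real.cos ((js.getD k 0 : ℝ) / 500 * Real.log (((j : ℕ) + 2 : ℕ) : ℝ))
          + (Real.cos ((js.getD k 0 : ℝ) / 500 * Real.log (((i : ℕ) + 2 : ℕ) : ℝ))
              * Real.cos ((js.getD k 0 : ℝ) / 500 * Real.log (((j : ℕ) + 2 : ℕ) : ℝ))
            + Real.sin ((js.getD k 0 : ℝ) / 500 * Real.log (((i : ℕ) + 2 : ℕ) : ℝ))
              * Real.sin ((js.getD k 0 : ℝ) / 500 * Real.log (((j : ℕ) + 2 : ℕ) : ℝ)))) := by
    intro k hk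
    rw [Finset.mem_range] at hk
    have hj0 : (js.getD k 0 : ℝ) ≠ 0 := by
      have := hpos k hk
      positivity
    rw [mul_sub, Real.cos_sub]
    field_simp
  rw [Finset.sum_congr rfl hsum]
  ring

/-- The remainder of the witness is symmetric. -/
theorem remainder_symm {n K WJ : ℕ} {js oms : List ℕ} (hpos : ∀ k, k < K → 0 < js.getD k 0) (i j : Fin n) :
    remainder n K (fun k : Fin K => (js.getD k 0 : ℝ) / 500)
      (fun k : Fin K => (oms.getD k 0 : ℝ) / 2 ^ 60 * ((js.getD k 0 : ℝ) / 500) ^ 2) ((WJ : ℝ) / 2 ^ 60) i j =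
      remainder n K (fun k : Fin K => (js.getD k 0 : ℝ) / 500)
      (fun k : Fin K => (oms.getD k 0 : ℝ) / 2 ^ 60 * ((js.getD k 0 : ℝ) / 500) ^ 2) ((WJ : ℝ) / 2 ^ 60) j i := by
  rw [remainder_entry hpos, remainder_entry hpos]
  have hS : screwMatrix n j i = screwMatrix n i j := by
    simpa using (screwMatrix_isHermitian n).apply i j
  rw [← hS]
  unfold PR
  congr 2
  refine Finset.sum_congr rfl fun k _ => ?_
  ring

/-! ### The S-entries from a valid u-table -/

/-- Off-diagonal entry of `S_{n+1}` for nodes `a = i+2 > b = j+2`. -/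
theorem screw_offdiag {n : ℕ} (i j : Fin n) (hij : (j : ℕ) < (i : ℕ)) :
    screwMatrix n i j = RungCert.lerchC / 4 + RungCert.uR ((i : ℕ) + 2) 1 + RungCert.uR ((j : ℕ) + 2) 1 -
      RungCert.uR ((i : ℕ) + 2) ((j : ℕ) + 2) := by
  rw [RungCert.screwMatrix_eq_tMat]
  have hne : i ≠ j := fun h => by subst h; exact lt_irrefl _ hij
  simp only [RungCert.tMat, Matrix.of_apply, if_neg hne, max_eq_left hij.le, min_eq_right hij.le]

/-- Diagonal entry of `S_{n+1}` for node `a = i+2`. -/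
theorem screw_diag {n : ℕ} (i : Fin n) :
    screwMatrix n i i = RungCert.lerchC / 2 + 2 * RungCert.uR ((i : ℕ) + 2) 1 := by
  rw [RungCert.screwMatrix_eq_tMat]
  simp [RungCert.tMat]


/-! ### From the row invariant to the checker's hypotheses -/

/-- The true value of the fast rows is the true value of the error analysis (`τ = 500`). -/
theorem ztrue_log (js : List ℕ) (k m : ℕ) : ztrue js k (Real.log m) = zT 500 (js.getD k 0) m := by
  unfold ztrue zT
  norm_num

/-- A correct row (`RowOK`, units `U_k ≤ 1/26`) is in range: every stored component has `|x| ≤ 2^53`. -/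
theorem rowSmall_of_rowOK {Wmax m : ℕ} {js : List ℕ} {dr : ℕ × List (ℕ × ℕ)} (h : RowOK Wmax 500 js m dr)
    (hU : ∀ k, k < js.length → Uk Wmax 500 (js.getD k 0) ≤ 1 / 26) : RowSmall dr.2 := by
  intro p hp
  obtain ⟨-, h8, hlen, herr⟩ := h
  rw [List.mem_iff_getElem] at hp
  obtain ⟨k, hk, rfl⟩ := hp
  have hk' : k < js.length := by rw [← hlen]; exact hk
  have he := herr k hk'
  rw [List.getD_eq_getElem _ _ hk] at he
  have hzT : ‖zT 500 (js.getD k 0) m‖ = 1 := norm_exp_real_mul_I _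
  have hU0 : 0 ≤ Uk Wmax 500 (js.getD k 0) := by unfold Uk; positivity
  have h15 : (2 * (dr.1 : ℝ) - 1) * Uk Wmax 500 (js.getD k 0) ≤ 15 * (1 / 26) := by
    have hd : (2 * (dr.1 : ℝ) - 1) ≤ 15 := by
      have : (dr.1 : ℝ) ≤ 8 := by exact_mod_cast h8
      linarith
    calc (2 * (dr.1 : ℝ) - 1) * Uk Wmax 500 (js.getD k 0) ≤ 15 * Uk Wmax 500 (js.getD k 0) :=
          mul_le_mul_of_nonneg_right hd hU0
      _ ≤ 15 * (1 / 26) := mul_le_mul_of_nonneg_left (hU k hk') (by norm_num)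
  have hn : ‖zOf (dr.2[k]).1 (dr.2[k]).2‖ ≤ 2 := by
    have := norm_sub_norm_le (zOf (dr.2[k]).1 (dr.2[k]).2) (zT 500 (js.getD k 0) m)
    linarith
  obtain ⟨ha, hb⟩ := abs_oval_le_of_zOf (dr.2[k]).1 (dr.2[k]).2
  have hS : (SCL : ℝ) = 2 ^ 52 := by norm_num [SCL]
  rw [hS] at ha hb
  have ha' : (|oval (dr.2[k]).1| : ℝ) ≤ 2 ^ 53 := by nlinarith
  have hb' : (|oval (dr.2[k]).2| : ℝ) ≤ 2 ^ 53 := by nlinarith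
  exact ⟨by exact_mod_cast ha', by exact_mod_cast hb'⟩

/-- The error hypothesis of `num_err`/`numD_err` at a node `m`, from `RowOK`. -/
theorem zhat_err_of_rowOK {Wmax m : ℕ} {js : List ℕ} {dr : ℕ × List (ℕ × ℕ)} (h : RowOK Wmax 500 js m dr) :
    ∀ k, k < js.length → ‖zhat dr.2 k - ztrue js k (Real.log m)‖ ≤ (2 * dr.1 - 1 : ℝ) * Uk Wmax 500 (js.getD k 0) := by
  intro k hk
  rw [ztrue_log]
  exact h.2.2.2 k hk

/-! ### The pair bound and the diagonal bound (offset arithmetic, no truncation) -/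

/-- **The pair bound.**  For two packed nodes whose fields have the integer values of `packNodeB` (`hxa … hyb`), whose
Kronecker dot products satisfy the pair identity `kc + ks + POS − (NA + NB) = Num` (`hnum`, `pair_num`), under the size
caps of `fastLight`, and for a real `R` bracketed by the S-entry digits and the numerator (`hlo`, `hhi`):
`2^164 |R| ≤ pairAbs …`. -/
theorem pairAbs_ge {sh CL CH POS NA NB F4 F45 ua1 ua2 ub1 ub2 : ℕ} {Pa Pb : NodeP} {uab : ℕ × ℕ} {Nm : ℤ} {R : ℝ}
    (hxa : (Pa.xa : ℤ) = ua1 + NA + ZB - F4) (hxb : (Pb.xb : ℤ) = ub1 + NB + ZB - F45)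
    (hya : (Pa.ya : ℤ) = ua2 + NA + F4) (hyb : (Pb.yb : ℤ) = ub2 + NB + F45)
    (hnum : (kdotS sh Pa.uc Pb.vc : ℤ) + kdotS sh Pa.us Pb.vs + POS - (NA + NB) = Nm)
    (hPOS : POS ≤ 2 ^ 178) (hF4 : F4 ≤ 2 ^ 172) (hF45 : F45 ≤ 2 ^ 173) (huab1 : uab.1 < 2 ^ 174)
    (huab2 : uab.2 < 2 ^ 174)
    (hlo : (CL : ℝ) + ua1 + ub1 - uab.2 - Nm - F4 - F45 ≤ 2 ^ 164 * R + OZ)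
    (hhi : 2 ^ 164 * R + OZ ≤ (CH : ℝ) + ua2 + ub2 - uab.1 - Nm + F4 + F45) :
    2 ^ 164 * |R| ≤ (pairAbs sh (CL + 2 * ZB - POS + Pa.xa) (CH + 2 * ZB - POS + Pa.ya) Pa Pb uab : ℝ) := by
  rw [pairAbs_eq]
  have e1 := offsetA1 (CL := CL) hxa hxb hnum hPOS hF4 hF45 huab2 (kdotS_lt sh Pa.uc Pb.vc)
    (kdotS_lt sh Pa.us Pb.vs)
  have e2 := offsetA2 (CH := CH) hya hyb hnum hPOS huab1 (kdotS_lt sh Pa.uc Pb.vc) (kdotS_lt sh Pa.us Pb.vs)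
  have r1 := congrArg (Int.cast : ℤ → ℝ) e1
  have r2 := congrArg (Int.cast : ℤ → ℝ) e2
  push_cast at r1 r2
  exact abs_le_pairMax r1 r2 (by linarith) (by linarith)

/-- **The diagonal bound is not truncated** when it is positive (which the row test forces). -/
theorem diagLoN_cast {CL WJS2 E1 : ℕ} {Pa : NodeP} (h : 0 < diagLoN CL WJS2 E1 Pa) :
    ((diagLoN CL WJS2 E1 Pa : ℕ) : ℝ) =
      2 * CL + 2 * Pa.ulo + 2 ^ 53 * Pa.lwc + 2 * E1 + ZB - (WJS2 + 4 * Pa.d * E1) := by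
  rw [diagLoN_eq] at h ⊢
  have hle : WJS2 + 4 * Pa.d * E1 ≤ 2 * CL + 2 * Pa.ulo + 2 ^ 53 * Pa.lwc + 2 * E1 + ZB :=
    (Nat.lt_of_sub_pos h).le
  rw [Nat.cast_sub hle]
  push_cast
  ring

/-- **The diagonal bound**: `diagLoN ≤ 2^164 (S_aa − Pd_a) + 2·OZ + ZB` from the digit sum `lwc = L_c + K·D0`, the
scaled digit `ulo ≤ 2^164 u(a,1) + OZ`, `CL ≤ 2^162 C`, `S_aa = C/2 + 2u(a,1)` and the diagonal numerator error. -/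
theorem diagLoN_le {CL WJS2 E1 K WJ da : ℕ} {oms js : List ℕ} {ra : List (ℕ × ℕ)} {Pa : NodeP} {S u C x E : ℝ}
    (hpos : 0 < diagLoN CL WJS2 E1 Pa) (hd : Pa.d = da) (hlwc : (Pa.lwc : ℤ) = Lc oms ra K + K * D0)
    (hWJS2 : (WJS2 : ℤ) = 2 ^ 104 * (2 * So oms K + WJ) + 2 ^ 53 * K * D0)
    (hulo : (Pa.ulo : ℝ) ≤ 2 ^ 164 * u + OZ) (hCL : (CL : ℝ) ≤ 2 ^ 162 * C)
    (herr : |(NumD oms ra K WJ : ℝ) - 2 ^ 164 * PRd js oms WJ K x| ≤ (4 * da - 2 : ℝ) * E) (hE : E ≤ E1)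
    (hda1 : 1 ≤ da) (hS : S = C / 2 + 2 * u) :
    ((diagLoN CL WJS2 E1 Pa : ℕ) : ℝ) ≤ 2 ^ 164 * (S - PRd js oms WJ K x) + 2 * OZ + ZB := by
  rw [diagLoN_cast hpos, hd, hS]
  have hN : (2 : ℝ) ^ 53 * Pa.lwc - WJS2 = -(NumD oms ra K WJ : ℝ) := by
    have h1 := congrArg (Int.cast : ℤ → ℝ) hlwc
    have h2 := congrArg (Int.cast : ℤ → ℝ) hWJS2
    push_cast [NumD] at h1 h2 ⊢
    rw [h1, h2]
    ring
  have hda' : (1 : ℝ) ≤ da := by exact_mod_cast hda1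
  have hcoef : (0 : ℝ) ≤ 4 * da - 2 := by linarith
  have hmul : (4 * da - 2 : ℝ) * E ≤ (4 * da - 2 : ℝ) * E1 := mul_le_mul_of_nonneg_left hE hcoef
  obtain ⟨he1, -⟩ := abs_le.1 herr
  linarith

/-- **The pair bracket** of the remainder entry `R = S − P` (`S = C/4 + u₁ + u₂ − u₁₂`) by the scaled digits, the
`ζ(2,¼)` bracket and the pair numerator (error `(4d_a + 4d_b + 5)·E1`). -/
theorem pair_bracket {K WJ Wmax da db CL CH E1 ua1 ua2 ub1 ub2 uab1 uab2 : ℕ} {js oms : List ℕ}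
    {ra rb : List (ℕ × ℕ)} {xa xb S C u1 u2 u12 : ℝ}
    (hea : ∀ k, k < K → ‖zhat ra k - ztrue js k xa‖ ≤ (2 * da - 1 : ℝ) * Uk Wmax 500 (js.getD k 0))
    (heb : ∀ k, k < K → ‖zhat rb k - ztrue js k xb‖ ≤ (2 * db - 1 : ℝ) * Uk Wmax 500 (js.getD k 0))
    (hU : ∀ k, k < K → Uk Wmax 500 (js.getD k 0) ≤ 1 / 26) (hda : da ≤ 8) (hdb : db ≤ 8) (hda1 : 1 ≤ da)
    (hdb1 : 1 ≤ db) (hE : 2 ^ 104 * ∑ k ∈ range K, (oms.getD k 0 : ℝ) * Uk Wmax 500 (js.getD k 0) ≤ E1)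
    (hCL : (CL : ℝ) ≤ 2 ^ 162 * C) (hCH : 2 ^ 162 * C ≤ CH)
    (hua1 : (ua1 : ℝ) ≤ 2 ^ 164 * u1 + OZ) (hua2 : 2 ^ 164 * u1 + OZ ≤ ua2)
    (hub1 : (ub1 : ℝ) ≤ 2 ^ 164 * u2 + OZ) (hub2 : 2 ^ 164 * u2 + OZ ≤ ub2)
    (huab1 : (uab1 : ℝ) ≤ 2 ^ 164 * u12 + OZ) (huab2 : 2 ^ 164 * u12 + OZ ≤ uab2)
    (hS : S = C / 4 + u1 + u2 - u12) :
    (CL : ℝ) + ua1 + ub1 - uab2 - Num oms ra rb K WJ - ((4 * da * E1 : ℕ) : ℝ) - (((4 * db + 5) * E1 : ℕ) : ℝ) ≤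
        2 ^ 164 * (S - PR js oms WJ K xa xb) + OZ ∧
      2 ^ 164 * (S - PR js oms WJ K xa xb) + OZ ≤
        (CH : ℝ) + ua2 + ub2 - uab1 - Num oms ra rb K WJ + ((4 * da * E1 : ℕ) : ℝ) + (((4 * db + 5) * E1 : ℕ) : ℝ) := by
  have herr := num_err (oms := oms) (WJ := WJ) hea heb hU hda hdb hda1 hdb1
  have hcoef : (0 : ℝ) ≤ 4 * da + 4 * db + 5 := by positivity
  have hmul := mul_le_mul_of_nonneg_left hE hcoef
  obtain ⟨h1, h2⟩ := abs_le.1 (herr.trans hmul)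
  have hF : ((4 * da * E1 : ℕ) : ℝ) + (((4 * db + 5) * E1 : ℕ) : ℝ) = (4 * da + 4 * db + 5 : ℝ) * E1 := by
    push_cast; ring
  rw [hS]
  constructor
  · linarith
  · linarith

end Summit.RiemannHypothesis.RiemannHypothesis.Theorems.IntegerScrew.Manifest.Fast
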